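import Mathlib.Algebra.Order.Floor.Defs
import Mathlib.Algebra.Order.Archimedean.Real.Basic
import Mathlib.Data.Int.LeastGreatest
import Mathlib.Order.Monotone.Basic
import Mathlib.Tactic.Linarith
import Mathlib.Tactic.Positivity
import Mathlib.Tactic.Ring
import Mathlib.Tactic.FieldSimp
import HarnessLib

/-!
# Cells of a periodic two-sided chain on the line (the circle of an ideal class, abstractly)

Topic `Literature/NumberTheory/CubicFields`. The purely real-variable skeleton of the "circle of reduced ideals of an ideal
class" of a number field of unit rank one (Buchmann–Williams 1988 §3; Hallgren 2005 §4): a strictly increasing map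
`G : ℤ → ℝ` (the logarithms `log σ₁ θ(i)` along a Voronoi chain) with a period `G (i + n₀) = G i + R`, `n₀ ≥ 1` (the
regulator unit). Such a chain is unbounded in both directions, so every real `x` lies in exactly one CELL
`G i ≤ x < G (i + 1)`:

* `chain_period_pos`, `chain_add_mul_period` — `0 < R`, `G (i + k n₀) = G i + k R`;
* `chain_exists_index`, `chain_index_unique`, `chain_exists_indexFn` — the index `idx x` of the cell of `x`;
* `chain_index_eq`, `chain_index_add_period`, `chain_index_mono` — its characterisation, periodicity and monotonicity;
* `chain_floor_add_period` — the sub-cell offset `⌊(x − G (idx x)) N⌋₊` is `R`-periodic;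
* `chain_cell_eq_of_no_breakpoint` — if no BREAKPOINT `G k + m/N` (`m/N` below the gap `G (k+1) − G k`) lies in
  `(u, v]`, then `u` and `v` have the same index and the same offset (the cell function `x ↦ (label (idx x), offset)` is
  constant on breakpoint-free intervals);
* `chain_far_iff`, `chain_no_breakpoint_of_far` — the `η`-far-from-breakpoints condition used for defect sets.

Theorem-only file, no number theory.

## References

* J. Buchmann, H. C. Williams, *On the infrastructure of the principal ideal class of an algebraic number field of unit
  rank one*, Math. Comp. 50 (1988), §3. [BuchmannWilliams1988Infrastructure]
* S. Hallgren, *Fast quantum algorithms for computing the unit group and class group of a number field*, STOC 2005, §4.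
-/

namespace Literature.NumberTheory.CubicFields

section PeriodicChain

variable {G : ℤ → ℝ} (hG : StrictMono G) {n₀ : ℕ} (hn₀ : 0 < n₀) {R : ℝ} (hper : ∀ i, G (i + n₀) = G i + R)

include hG hn₀ hper in
/-- The period is positive. [folklore] -/
theorem chain_period_pos : 0 < R := by
  have h := hper 0
  have hlt : G 0 < G (0 + n₀) := hG (by omega)
  linarith

include hper in
/-- Iterated period: `G (i + k n₀) = G i + k R` (`k : ℕ`). [folklore] -/
theorem chain_add_nat_mul_period (i : ℤ) (k : ℕ) : G (i + k * n₀) = G i + k * R := by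
  induction k with
  | zero => simp
  | succ k ih =>
    have : i + ((k + 1 : ℕ) : ℤ) * n₀ = (i + k * n₀) + n₀ := by push_cast; ring
    rw [this, hper, ih]; push_cast; ring

include hper in
/-- Iterated period: `G (i + k n₀) = G i + k R` (`k : ℤ`). [folklore] -/
theorem chain_add_mul_period (i k : ℤ) : G (i + k * n₀) = G i + k * R := by
  obtain ⟨k, rfl | rfl⟩ := Int.eq_nat_or_neg k
  · exact_mod_cast chain_add_nat_mul_period hper i k
  · have h := chain_add_nat_mul_period hper (i + -(k : ℤ) * n₀) k
    rw [show i + -(k : ℤ) * n₀ + (k : ℤ) * n₀ = i by ring] at h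
    push_cast; linarith

include hG hn₀ hper in
/-- The chain goes below every real. [folklore] -/
theorem chain_exists_le (x : ℝ) : ∃ i, G i ≤ x := by
  have hR := chain_period_pos hG hn₀ hper
  obtain ⟨k, hk⟩ := Archimedean.arch (G 0 - x) hR
  refine ⟨0 + -(k : ℤ) * n₀, ?_⟩
  rw [chain_add_mul_period hper]
  simp only [nsmul_eq_mul] at hk
  push_cast; linarith

include hG hn₀ hper in
/-- The chain goes above every real. [folklore] -/
theorem chain_exists_gt (x : ℝ) : ∃ i, x < G i := by
  have hR := chain_period_pos hG hn₀ hper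
  obtain ⟨k, hk⟩ := Archimedean.arch (x - G 0 + 1) hR
  refine ⟨0 + (k : ℤ) * n₀, ?_⟩
  rw [chain_add_mul_period hper]
  simp only [nsmul_eq_mul] at hk
  push_cast; linarith

include hG hn₀ hper in
/-- **Every real lies in a cell** `G i ≤ x < G (i + 1)`. [folklore] -/
theorem chain_exists_index (x : ℝ) : ∃ i : ℤ, G i ≤ x ∧ x < G (i + 1) := by
  obtain ⟨j, hj⟩ := chain_exists_gt hG hn₀ hper x
  obtain ⟨i₀, hi₀⟩ := chain_exists_le hG hn₀ hper x
  obtain ⟨i, hi, hmax⟩ := Int.exists_greatest_of_bdd (P := fun i => G i ≤ x) ⟨j, fun z hz => by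
    by_contra h
    push Not at h
    have := hG.monotone h.le
    linarith⟩ ⟨i₀, hi₀⟩
  refine ⟨i, hi, ?_⟩
  by_contra h
  push Not at h
  have := hmax (i + 1) h
  omega

include hG in
/-- **The cell is unique.** [folklore] -/
theorem chain_index_unique {x : ℝ} {i j : ℤ} (hi : G i ≤ x) (hi' : x < G (i + 1)) (hj : G j ≤ x) (hj' : x < G (j + 1)) :
    i = j := by
  by_contra h
  rcases lt_or_gt_of_ne h with h | h
  · have : G (i + 1) ≤ G j := hG.monotone (by omega)
    linarith
  · have : G (j + 1) ≤ G i := hG.monotone (by omega)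
    linarith

include hG hn₀ hper in
/-- **The index function** of the chain. [folklore] -/
theorem chain_exists_indexFn : ∃ idx : ℝ → ℤ, ∀ x, G (idx x) ≤ x ∧ x < G (idx x + 1) :=
  ⟨fun x => (chain_exists_index hG hn₀ hper x).choose, fun x => (chain_exists_index hG hn₀ hper x).choose_spec⟩

variable {idx : ℝ → ℤ} (hidx : ∀ x, G (idx x) ≤ x ∧ x < G (idx x + 1))

include hG hidx in
/-- Characterisation of the index. [folklore] -/
theorem chain_index_eq {x : ℝ} {i : ℤ} (hi : G i ≤ x) (hi' : x < G (i + 1)) : idx x = i :=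
  chain_index_unique hG (hidx x).1 (hidx x).2 hi hi'

include hG hper hidx in
/-- **Periodicity of the index**: `idx (x + R) = idx x + n₀`. [folklore] -/
theorem chain_index_add_period (x : ℝ) : idx (x + R) = idx x + n₀ := by
  apply chain_index_eq hG hidx
  · rw [hper]; linarith [(hidx x).1]
  · rw [show idx x + n₀ + 1 = (idx x + 1) + n₀ by ring, hper]; linarith [(hidx x).2]

include hG hidx in
/-- The index is monotone. [folklore] -/
theorem chain_index_mono {x y : ℝ} (hxy : x ≤ y) : idx x ≤ idx y := by
  by_contra h
  push Not at h
  have : G (idx y + 1) ≤ G (idx x) := hG.monotone (by omega)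
  linarith [(hidx x).1, (hidx y).2]

include hG hper hidx in
/-- **Periodicity of the offset**: `x + R − G (idx (x + R)) = x − G (idx x)`. [folklore] -/
theorem chain_sub_index_add_period (x : ℝ) : x + R - G (idx (x + R)) = x - G (idx x) := by
  rw [chain_index_add_period hG hper hidx, hper]; ring

include hG hper hidx in
/-- The sub-cell offset `⌊(x − G (idx x)) N⌋₊` is `R`-periodic. [folklore] -/
theorem chain_floor_add_period (N : ℝ) (x : ℝ) :
    ⌊(x + R - G (idx (x + R))) * N⌋₊ = ⌊(x - G (idx x)) * N⌋₊ := by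
  rw [chain_sub_index_add_period hG hper hidx]

include hG hidx in
/-- **The cell function is constant on breakpoint-free intervals.** If no breakpoint `G k + m/N` with `m/N` below the
gap `G (k + 1) − G k` lies in `(u, v]` (`u ≤ v`, `N > 0`), then `u` and `v` have the same index and the same offset.
[cite: BuchmannWilliams1988Infrastructure, §3] -/
theorem chain_cell_eq_of_no_breakpoint {N : ℝ} (hN : 0 < N) {u v : ℝ} (huv : u ≤ v)
    (hfree : ∀ (k : ℤ) (m : ℕ), (m : ℝ) / N < G (k + 1) - G k → ¬ (u < G k + m / N ∧ G k + m / N ≤ v)) :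
    idx u = idx v ∧ ⌊(u - G (idx u)) * N⌋₊ = ⌊(v - G (idx v)) * N⌋₊ := by
  set i := idx u with hi
  have hu := hidx u
  -- the index of `v`
  have hv' : v < G (i + 1) := by
    by_contra h
    push Not at h
    have hgap : ((0 : ℕ) : ℝ) / N < G (i + 1 + 1) - G (i + 1) := by
      rw [Nat.cast_zero, zero_div, sub_pos]; exact hG (by omega)
    exact hfree (i + 1) 0 hgap ⟨by rw [Nat.cast_zero, zero_div, add_zero]; exact hu.2, by
      rw [Nat.cast_zero, zero_div, add_zero]; exact h⟩
  have hiv : idx v = i := chain_index_eq hG hidx (hu.1.trans huv) hv'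
  refine ⟨hiv.symm, ?_⟩
  rw [hiv]
  -- the offsets
  have h0u : 0 ≤ (u - G i) * N := mul_nonneg (sub_nonneg.2 hu.1) hN.le
  have h0v : 0 ≤ (v - G i) * N := mul_nonneg (sub_nonneg.2 (hu.1.trans huv)) hN.le
  have hle : ⌊(u - G i) * N⌋₊ ≤ ⌊(v - G i) * N⌋₊ :=
    Nat.floor_le_floor (mul_le_mul_of_nonneg_right (sub_le_sub_right huv _) hN.le)
  refine le_antisymm hle ?_
  by_contra hlt
  push Not at hlt
  set m : ℕ := ⌊(u - G i) * N⌋₊ + 1 with hm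
  have hm1 : (u - G i) * N < m := by rw [hm]; push_cast; exact Nat.lt_floor_add_one _
  have hm2 : (m : ℝ) ≤ (v - G i) * N := by
    have : m ≤ ⌊(v - G i) * N⌋₊ := by rw [hm]; omega
    exact le_trans (by exact_mod_cast this) (Nat.floor_le h0v)
  have hmN1 : u < G i + m / N := by
    rw [← sub_lt_iff_lt_add', lt_div_iff₀ hN]; exact hm1
  have hmN2 : G i + m / N ≤ v := by
    rw [← le_sub_iff_add_le', div_le_iff₀ hN]; exact hm2
  have hgap : (m : ℝ) / N < G (i + 1) - G i := by
    rw [div_lt_iff₀ hN]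
    have : (v - G i) * N < (G (i + 1) - G i) * N := mul_lt_mul_of_pos_right (by linarith) hN
    linarith
  exact hfree i m hgap ⟨hmN1, hmN2⟩

include hG in
/-- Far from all breakpoints (distance `> η`) implies no breakpoint in `(x − η', x + η']` for `η' ≤ η`… stated as the
breakpoint-freeness of `(u, v]` whenever `[u, v] ⊆ [x − η, x + η]`. [folklore] -/
theorem chain_no_breakpoint_of_far {N η x u v : ℝ} (hux : x - η ≤ u) (hvx : v ≤ x + η)
    (hfar : ∀ (k : ℤ) (m : ℕ), (m : ℝ) / N < G (k + 1) - G k → η < |x - (G k + m / N)|) :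
    ∀ (k : ℤ) (m : ℕ), (m : ℝ) / N < G (k + 1) - G k → ¬ (u < G k + m / N ∧ G k + m / N ≤ v) := by
  have _ := hG
  intro k m hgap ⟨h1, h2⟩
  have h := hfar k m hgap
  rw [lt_abs] at h
  rcases h with h | h <;> linarith

include hG in
/-- Far from all breakpoints implies far from all chain points (`m = 0`). [folklore] -/
theorem chain_far_point_of_far {N η x : ℝ}
    (hfar : ∀ (k : ℤ) (m : ℕ), (m : ℝ) / N < G (k + 1) - G k → η < |x - (G k + m / N)|) (k : ℤ) :
    η < |x - G k| := by
  have h := hfar k 0 (by rw [Nat.cast_zero, zero_div, sub_pos]; exact hG (by omega))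
  simpa using h

end PeriodicChain

end Literature.NumberTheory.CubicFields
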